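import Literature.Analysis.FluidPDE.CheskidovScalarEstimates
import Literature.Analysis.FluidPDE.EnergyToolkit
import Literature.Analysis.FunctionSpaces.TorusDiffMonomialBounds
import HarnessLib

/-!
# The restart dichotomy of dissipation enhancement and viscous–inviscid closeness in product form

Topic `Literature/Analysis/FluidPDE` (support file, all results proved; no definitions, no named
facts) for the accepted notion `Torus.IsClassicalScalarTransportOn S κ u θ` (`PassiveScalar`) of a
classical solution of `∂ₜθ + u·∇θ = κΔθ` with a smooth divergence-free drift on `T^d`.
Two elementary steps of Feng–Iyer's proof of dissipation enhancement for the advection–diffusion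
equation (Feng–Iyer 2019, §5.1; Cheskidov 2023, §4):

* **the restart dichotomy** `….scalarL2Sq_le_or_exists_scalarGradNormSq_le` — on a window
  `[s, s + τ] ⊆ S`, `κ > 0`, for any `c`: EITHER `‖θ(s + τ)‖² ≤ (1 - c)‖θ(s)‖²`, OR there is
  `t₁ ∈ [s, s + τ/2]` with `‖∇θ(t₁)‖² ≤ c‖θ(s)‖²/(κτ)` (the energy identity
  `‖θ(s + τ)‖² + 2κ∫ₛ^{s+τ}‖∇θ‖² = ‖θ(s)‖²` and Chebyshev / the minimum of a continuous function is
  at most its mean; Feng–Iyer's alternative "`‖θ‖₁²/‖θ‖²` large on the whole window, hence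
  exponential decay" versus "`‖θ_{s,0}‖₁² < λ_N‖θ_{s,0}‖²` at a restart time"), with the general
  sub-window form `….exists_scalarGradNormSq_le_of_lt`;
* **the energy identity for two diffusivities** `….hasDerivWithinAt_integral_sub_sq_of_diffusivities`
  — for `θ` (diffusivity `κ`) and `φ` (diffusivity `κ'`) with the SAME drift,
  `d/dt ‖θ - φ‖² = -2κ‖∇θ‖² - 2κ'‖∇φ‖² + 2(κ + κ')∫⟪∇θ, ∇φ⟫` (the transport term vanishes by
  incompressibility; Green's first identity);
* **viscous–inviscid closeness in product form** `….integral_sub_sq_le_sqrt_mul_sqrt` — for `θ`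
  (diffusivity `κ ≥ 0`) and `φ` (diffusivity `0`) with the same drift and `θ(a) = φ(a)`:
  `‖θ(t) - φ(t)‖²_{L²} ≤ 2κ (∫ₐᵗ‖∇θ‖²)^{1/2} (∫ₐᵗ‖∇φ‖²)^{1/2}`, i.e. Cheskidov's (4.3)
  `sup‖θ - ρ‖² ≤ (2ν∫‖∇ρ‖²)^{1/2}(2ν∫‖∇θ‖²)^{1/2}` (the tree's
  `….integral_sub_sq_le` of `CheskidovScalarEstimates` is the variant `≤ (κ/2)∫ₐᵗ‖∇φ‖²`; the
  product form keeps the small viscous dissipation `2κ∫‖∇θ‖²` as a factor, which is how Feng–Iyer's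
  Lemma 5.3 enters the proof of Lemma 5.2).

Requested by the cell ad-ideate-p2 (LIT-ASK L7, block B1 of the K1loc split).

## Mathlib / tree search

Tree (reused): `IsClassicalScalarTransportOn.scalarL2Sq_add_scalarDissipation_holds`,
`….continuousOn_scalarGradNormSq`, `….restrict_Icc` (`PassiveScalarClassicalEnergy`),
`Torus.integral_mul_laplacian_eq_neg_integral_inner_gradient`,
`Torus.integral_mul_inner_gradient_self_eq_zero` (`CheskidovScalarEstimates`,
`PassiveScalarClassicalEnergy`), `FunctionSpaces.Torus.integral_mul_le_sqrt_mul_sqrt`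
(`TorusDiffMonomialBounds`), `integral_mul_le_sqrt_mul_sqrt_of_memLp` (`EnergyToolkit`);
searched `restart`, `dichotomy`, `exists_scalarGradNormSq`, `of_diffusivities`: none. Mathlib:
`IsCompact.exists_isMinOn`, `intervalIntegral.integral_mono_interval`,
`memLp_two_iff_integrable_sq`.

## References

* Y. Feng, G. Iyer, *Dissipation enhancement by mixing*, Nonlinearity 32 (2019) 1810–1851,
  arXiv:1806.03699, §5.1: the energy identity and the decay alternative preceding Lemma 5.2, and
  Lemma 5.3 (`L²` closeness of the diffusive and the transported scalar). [FengIyer2019]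
* A. Cheskidov, *Dissipation anomaly and anomalous dissipation in incompressible fluid flows*,
  arXiv:2311.04182 (2023), §4, (4.3). [Cheskidov2023]
-/

open MeasureTheory Set Filter
open _root_.Topology
open scoped InnerProductSpace ContDiff ENNReal NNReal

noncomputable section

namespace Literature.Analysis.FluidPDE

namespace Torus

variable {d : Type*} [Fintype d] [DecidableEq d]

/-! ## Two elementary real-variable lemmas -/

omit [Fintype d] [DecidableEq d] in
/-- The minimum of a function continuous on `[a, b]`, `a < b`, is at most its mean:
`∃ t₁ ∈ [a, b], g(t₁)(b - a) ≤ ∫ₐᵇ g`. [folklore] -/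
private theorem exists_mul_sub_le_integral {g : ℝ → ℝ} {a b : ℝ} (hab : a < b)
    (hg : ContinuousOn g (Icc a b)) :
    ∃ t₁ ∈ Icc a b, g t₁ * (b - a) ≤ ∫ s in a..b, g s := by
  obtain ⟨t₁, ht₁, hmin⟩ := isCompact_Icc.exists_isMinOn (nonempty_Icc.2 hab.le) hg
  refine ⟨t₁, ht₁, ?_⟩
  have hle : ∀ s ∈ Icc a b, g t₁ ≤ g s := fun s hs => isMinOn_iff.1 hmin s hs
  have hmono : ∫ _ in a..b, g t₁ ≤ ∫ s in a..b, g s :=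
    intervalIntegral.integral_mono_on hab.le intervalIntegrable_const
      (hg.intervalIntegrable_of_Icc hab.le) hle
  rw [intervalIntegral.integral_const, smul_eq_mul] at hmono
  linarith

omit [Fintype d] [DecidableEq d] in
/-- Cauchy–Schwarz in time for two nonnegative functions continuous on `[a, b]`:
`∫ₐᵇ √A √B ≤ (∫ₐᵇ A)^{1/2} (∫ₐᵇ B)^{1/2}`. [folklore] -/
private theorem integral_sqrt_mul_sqrt_le {A B : ℝ → ℝ} {a b : ℝ} (hab : a ≤ b)
    (hA : ContinuousOn A (Icc a b)) (hB : ContinuousOn B (Icc a b))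
    (hA0 : ∀ s ∈ Icc a b, 0 ≤ A s) (hB0 : ∀ s ∈ Icc a b, 0 ≤ B s) :
    ∫ s in a..b, Real.sqrt (A s) * Real.sqrt (B s) ≤
      Real.sqrt (∫ s in a..b, A s) * Real.sqrt (∫ s in a..b, B s) := by
  -- `√A`, `√B` are square integrable on `(a, b]`
  have hmem : ∀ {F : ℝ → ℝ}, ContinuousOn F (Icc a b) → (∀ s ∈ Icc a b, 0 ≤ F s) →
      MemLp (fun s => Real.sqrt (F s)) 2 (volume.restrict (Ioc a b)) ∧
        ∫ s in Ioc a b, Real.sqrt (F s) ^ 2 = ∫ s in Ioc a b, F s := by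
    intro F hF hF0
    have hsm : AEStronglyMeasurable (fun s => Real.sqrt (F s)) (volume.restrict (Ioc a b)) :=
      ((hF.mono Ioc_subset_Icc_self).sqrt).aestronglyMeasurable measurableSet_Ioc
    have heq : EqOn (fun s => Real.sqrt (F s) ^ 2) F (Ioc a b) := fun s hs =>
      Real.sq_sqrt (hF0 s (Ioc_subset_Icc_self hs))
    have hint : IntegrableOn F (Ioc a b) volume :=
      (hF.integrableOn_Icc (μ := volume)).mono_set Ioc_subset_Icc_self
    have hint2 : IntegrableOn (fun s => Real.sqrt (F s) ^ 2) (Ioc a b) volume :=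
      hint.congr_fun heq.symm measurableSet_Ioc
    exact ⟨(memLp_two_iff_integrable_sq hsm).2 hint2, setIntegral_congr_fun measurableSet_Ioc heq⟩
  obtain ⟨hAm, hAe⟩ := hmem hA hA0
  obtain ⟨hBm, hBe⟩ := hmem hB hB0
  have hcs := integral_mul_le_sqrt_mul_sqrt_of_memLp hAm hBm
  rw [hAe, hBe] at hcs
  simpa only [intervalIntegral.integral_of_le hab] using hcs

namespace IsClassicalScalarTransportOn

/-! ## The restart dichotomy -/

section Restart

variable {S : Set ℝ} {κ : ℝ} {u : ℝ → UnitAddTorus d → EuclideanSpace ℝ d}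
  {θ : ℝ → UnitAddTorus d → ℝ}

/-- **Small dissipation forces a time of small gradient** (general sub-window). For a classical
solution on `S ⊇ [s, s + τ]` with `κ > 0`: if `‖θ(s + τ)‖²_{L²} > (1 - c)‖θ(s)‖²_{L²}`, then by the
energy identity `2κ∫ₛ^{s+τ}‖∇θ‖² = ‖θ(s)‖² - ‖θ(s + τ)‖² < c‖θ(s)‖²`, so on any initial sub-window
`[s, s + τ']`, `0 < τ' ≤ τ`, some time `t₁` has `‖∇θ(t₁)‖²_{L²} ≤ c‖θ(s)‖²/(2κτ')` (the minimum of
the continuous `t ↦ ‖∇θ(t)‖²` is at most its mean). [cite: FengIyer2019, §5.1 (energy identity and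
the decay alternative preceding Lemma 5.2)] -/
theorem exists_scalarGradNormSq_le_of_lt (h : IsClassicalScalarTransportOn S κ u θ) (hκ : 0 < κ)
    {s τ τ' : ℝ} (hτ' : 0 < τ') (hτ'τ : τ' ≤ τ) (hS : Icc s (s + τ) ⊆ S) {c : ℝ}
    (hlt : (1 - c) * scalarL2Sq (θ s) < scalarL2Sq (θ (s + τ))) :
    ∃ t₁ ∈ Icc s (s + τ'), scalarGradNormSq (θ t₁) ≤ c * scalarL2Sq (θ s) / (2 * κ * τ') := by
  have hτ : 0 < τ := hτ'.trans_le hτ'τ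
  have hsτ : s ≤ s + τ := by linarith
  have hsτ' : s < s + τ' := by linarith
  -- the energy identity on `[s, s + τ]`
  have hid := scalarL2Sq_add_scalarDissipation_holds h hsτ hS
  simp only [scalarDissipation] at hid
  -- continuity and nonnegativity of `t ↦ ‖∇θ(t)‖²` on the window
  have h' := h.restrict_Icc (by linarith) hS
  have hGc : ContinuousOn (fun t => scalarGradNormSq (θ t)) (Icc s (s + τ)) :=
    h'.continuousOn_scalarGradNormSq (convex_Icc _ _) (uniqueDiffOn_Icc (by linarith))
  have hGi : IntervalIntegrable (fun t => scalarGradNormSq (θ t)) volume s (s + τ) :=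
    hGc.intervalIntegrable_of_Icc hsτ
  have hsub : Icc s (s + τ') ⊆ Icc s (s + τ) := Icc_subset_Icc le_rfl (by linarith)
  -- the dissipation on the sub-window is at most the dissipation on the window
  have hmono : ∫ t in s..(s + τ'), scalarGradNormSq (θ t) ≤ ∫ t in s..(s + τ), scalarGradNormSq (θ t) :=
    intervalIntegral.integral_mono_interval (μ := volume) (f := fun t => scalarGradNormSq (θ t))
      (c := s) (d := s + τ) (a := s) (b := s + τ') le_rfl hsτ'.le (by linarith)
      (Eventually.of_forall fun t => scalarGradNormSq_nonneg _) hGi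
  -- the minimum on the sub-window is at most the mean
  obtain ⟨t₁, ht₁, hmin⟩ := exists_mul_sub_le_integral hsτ' (hGc.mono hsub)
  refine ⟨t₁, ht₁, ?_⟩
  rw [le_div_iff₀ (by positivity)]
  have h1 : scalarGradNormSq (θ t₁) * τ' ≤ ∫ t in s..(s + τ), scalarGradNormSq (θ t) := by
    have : s + τ' - s = τ' := by ring
    rw [this] at hmin
    exact hmin.trans hmono
  nlinarith [h1, hid, hlt, hκ]

/-- **The restart dichotomy** (Feng–Iyer's alternative). For a classical solution of
`∂ₜθ + u·∇θ = κΔθ` (`κ > 0`, smooth divergence-free drift) on `S ⊇ [s, s + τ]`, `τ > 0`, and any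
`c`: EITHER the energy drops by the factor `1 - c` across the window,
`‖θ(s + τ)‖²_{L²} ≤ (1 - c)‖θ(s)‖²_{L²}`, OR there is a restart time `t₁ ∈ [s, s + τ/2]` in the first
half of the window at which the gradient is small, `‖∇θ(t₁)‖²_{L²} ≤ c‖θ(s)‖²_{L²}/(κτ)` (energy
identity + Chebyshev; in the source: "if `‖θ_s(t)‖₁² ≥ c₀‖θ_s(t)‖²` for all `t` in the window then
`‖θ_s(t)‖² ≤ e^{-2νc₀(t-s)}‖θ_{s,0}‖²`", else Lemma 5.2 restarts from a time with
`‖θ‖₁² < λ_N‖θ‖²`). [cite: FengIyer2019, §5.1 (the alternative preceding Lemma 5.2)] -/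
theorem scalarL2Sq_le_or_exists_scalarGradNormSq_le (h : IsClassicalScalarTransportOn S κ u θ)
    (hκ : 0 < κ) {s τ : ℝ} (hτ : 0 < τ) (hS : Icc s (s + τ) ⊆ S) (c : ℝ) :
    scalarL2Sq (θ (s + τ)) ≤ (1 - c) * scalarL2Sq (θ s) ∨
      ∃ t₁ ∈ Icc s (s + τ / 2), scalarGradNormSq (θ t₁) ≤ c * scalarL2Sq (θ s) / (κ * τ) := by
  by_cases hle : scalarL2Sq (θ (s + τ)) ≤ (1 - c) * scalarL2Sq (θ s)
  · exact Or.inl hle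
  · refine Or.inr ?_
    obtain ⟨t₁, ht₁, hb⟩ := h.exists_scalarGradNormSq_le_of_lt hκ (τ' := τ / 2) (by positivity)
      (by linarith) hS (lt_of_not_ge hle)
    refine ⟨t₁, ht₁, ?_⟩
    have : 2 * κ * (τ / 2) = κ * τ := by ring
    rwa [this] at hb

end Restart

/-! ## Two diffusivities, one drift: the energy identity for the difference -/

section Diffusivities

variable {S : Set ℝ} {κ κ' : ℝ} {u : ℝ → UnitAddTorus d → EuclideanSpace ℝ d}
  {θ φ : ℝ → UnitAddTorus d → ℝ}

/-- **Energy identity for the difference of two classical passive scalars with the same drift and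
different diffusivities.** For `∂ₜθ + u·∇θ = κΔθ` and `∂ₜφ + u·∇φ = κ'Δφ` on a convex time set `S`,
`w = θ - φ` satisfies, within `S`,
`d/dt ‖w(t)‖²_{L²} = -2κ‖∇θ‖² - 2κ'‖∇φ‖² + 2(κ + κ')∫⟪∇θ, ∇φ⟫`
(`∂ₜw + u·∇w = κΔθ - κ'Δφ`; multiply by `w`, integrate: `∫ w⟪u, ∇w⟫ = 0` by incompressibility and
`∫ wΔθ = -∫⟪∇w, ∇θ⟫`, `∫ wΔφ = -∫⟪∇w, ∇φ⟫` by Green's first identity).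
[cite: FengIyer2019, §5.1 Lemma 5.3 (proof: `∂ₜw + u·∇w - νΔw = νΔφ_s`, multiply by `w`)]
[cite: Cheskidov2023, §4 (proof of (4.3))] -/
theorem hasDerivWithinAt_integral_sub_sq_of_diffusivities (hθ : IsClassicalScalarTransportOn S κ u θ)
    (hφ : IsClassicalScalarTransportOn S κ' u φ) (hS : Convex ℝ S) {t : ℝ} (ht : t ∈ S) :
    HasDerivWithinAt (fun s => ∫ x, (θ s x - φ s x) ^ 2)
      (-(2 * κ) * scalarGradNormSq (θ t) - 2 * κ' * scalarGradNormSq (φ t) +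
        2 * (κ + κ') * ∫ x, ⟪FunctionSpaces.Torus.gradient (θ t) x,
          FunctionSpaces.Torus.gradient (φ t) x⟫_ℝ) S t := by
  by_cases hacc : AccPt t (𝓟 S)
  swap
  · exact HasFDerivWithinAt.of_not_accPt hacc
  have hU : UniqueDiffOn ℝ S :=
    uniqueDiffOn_convex hS (FunctionSpaces.Torus.interior_nonempty_of_convex_of_accPt hS ht hacc)
  set η : ℝ → UnitAddTorus d → ℝ := fun s x => θ s x - φ s x with hη_def
  have hηs : FunctionSpaces.Torus.IsSmoothSpaceTimeOn S η := hθ.smooth_scalar.sub hφ.smooth_scalar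
  have hηt : FunctionSpaces.Torus.IsSmooth (η t) := hηs.isSmooth_slice ht
  have hθt : FunctionSpaces.Torus.IsSmooth (θ t) := hθ.smooth_scalar.isSmooth_slice ht
  have hφt : FunctionSpaces.Torus.IsSmooth (φ t) := hφ.smooth_scalar.isSmooth_slice ht
  have hut : FunctionSpaces.Torus.IsSmooth (u t) := hθ.smooth_velocity.isSmooth_slice ht
  -- differentiate `∫ η²` under the integral sign
  have hψ : FunctionSpaces.Torus.IsSmoothSpaceTimeOn S (fun s x => η s x * η s x) := hηs.mul hηs
  have hE := hψ.hasDerivWithinAt_integral hS ht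
  have hdη : ∀ x, FunctionSpaces.Torus.timeDerivWithin S η t x =
      FunctionSpaces.Torus.timeDerivWithin S θ t x - FunctionSpaces.Torus.timeDerivWithin S φ t x := by
    intro x
    have h2 : HasDerivWithinAt (fun τ => η τ x)
        (FunctionSpaces.Torus.timeDerivWithin S θ t x - FunctionSpaces.Torus.timeDerivWithin S φ t x) S t :=
      (hθ.smooth_scalar.hasDerivWithinAt_slice ht x).sub (hφ.smooth_scalar.hasDerivWithinAt_slice ht x)
    rw [FunctionSpaces.Torus.timeDerivWithin, h2.derivWithin (hU t ht)]
  have htd : ∀ x, FunctionSpaces.Torus.timeDerivWithin S (fun s x => η s x * η s x) t x =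
      2 * (η t x * FunctionSpaces.Torus.timeDerivWithin S η t x) := by
    intro x
    have h2 : HasDerivWithinAt (fun τ => η τ x * η τ x)
        (FunctionSpaces.Torus.timeDerivWithin S η t x * η t x +
          η t x * FunctionSpaces.Torus.timeDerivWithin S η t x) S t :=
      (hηs.hasDerivWithinAt_slice ht x).mul (hηs.hasDerivWithinAt_slice ht x)
    rw [FunctionSpaces.Torus.timeDerivWithin, h2.derivWithin (hU t ht)]
    ring
  have hfun : (fun s => ∫ x, (θ s x - φ s x) ^ 2) = fun s => ∫ x, η s x * η s x := by
    funext s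
    simp only [sq, hη_def]
  rw [hfun]
  refine hE.congr_deriv ?_
  -- pointwise: `∂ₜη = κΔθ - κ'Δφ - ⟪u, ∇η⟫`
  have hηeq : η t = θ t - φ t := rfl
  have hgrad : ∀ x, FunctionSpaces.Torus.gradient (η t) x =
      FunctionSpaces.Torus.gradient (θ t) x - FunctionSpaces.Torus.gradient (φ t) x := by
    intro x
    rw [hηeq]
    exact FunctionSpaces.Torus.gradient_sub (hθt.isContDiff (by simp)) (hφt.isContDiff (by simp)) x
  have hpt : (fun x => FunctionSpaces.Torus.timeDerivWithin S (fun s x => η s x * η s x) t x) =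
      fun x => 2 * κ * (η t x * FunctionSpaces.Torus.laplacian (θ t) x) -
        2 * κ' * (η t x * FunctionSpaces.Torus.laplacian (φ t) x) -
        2 * (η t x * ⟪u t x, FunctionSpaces.Torus.gradient (η t) x⟫_ℝ) := by
    funext x
    rw [htd x, hdη x, hgrad x]
    have h1 := hθ.transport t ht x
    have h2 := hφ.transport t ht x
    have e1 : FunctionSpaces.Torus.timeDerivWithin S θ t x =
        κ * FunctionSpaces.Torus.laplacian (θ t) x - ⟪u t x, FunctionSpaces.Torus.gradient (θ t) x⟫_ℝ := by
      linarith
    have e2 : FunctionSpaces.Torus.timeDerivWithin S φ t x =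
        κ' * FunctionSpaces.Torus.laplacian (φ t) x - ⟪u t x, FunctionSpaces.Torus.gradient (φ t) x⟫_ℝ := by
      linarith
    rw [e1, e2, inner_sub_right]
    ring
  have i1 : Integrable (fun x => η t x * FunctionSpaces.Torus.laplacian (θ t) x) volume :=
    (hηt.smul' hθt.laplacian).integrable
  have i2 : Integrable (fun x => η t x * FunctionSpaces.Torus.laplacian (φ t) x) volume :=
    (hηt.smul' hφt.laplacian).integrable
  have i3 : Integrable (fun x => η t x * ⟪u t x, FunctionSpaces.Torus.gradient (η t) x⟫_ℝ) volume :=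
    (hηt.smul' (hut.inner hηt.gradient)).integrable
  have j1 : Integrable (fun x => 2 * κ * (η t x * FunctionSpaces.Torus.laplacian (θ t) x)) volume :=
    i1.const_mul _
  have j2 : Integrable (fun x => 2 * κ' * (η t x * FunctionSpaces.Torus.laplacian (φ t) x)) volume :=
    i2.const_mul _
  have j3 : Integrable (fun x => 2 * (η t x * ⟪u t x, FunctionSpaces.Torus.gradient (η t) x⟫_ℝ)) volume :=
    i3.const_mul _
  have j12 : Integrable (fun x => 2 * κ * (η t x * FunctionSpaces.Torus.laplacian (θ t) x) -
      2 * κ' * (η t x * FunctionSpaces.Torus.laplacian (φ t) x)) volume := j1.sub j2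
  -- Green's first identity for the two cross terms, and `⟪∇η, ∇θ⟫`, `⟪∇η, ∇φ⟫` expanded
  have g1 : ∫ x, η t x * FunctionSpaces.Torus.laplacian (θ t) x =
      -(scalarGradNormSq (θ t) - ∫ x, ⟪FunctionSpaces.Torus.gradient (θ t) x,
        FunctionSpaces.Torus.gradient (φ t) x⟫_ℝ) := by
    rw [integral_mul_laplacian_eq_neg_integral_inner_gradient hηt hθt]
    congr 1
    have k1 : Integrable (fun x => ⟪FunctionSpaces.Torus.gradient (θ t) x,
        FunctionSpaces.Torus.gradient (θ t) x⟫_ℝ) volume := (hθt.gradient.inner hθt.gradient).integrable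
    have k2 : Integrable (fun x => ⟪FunctionSpaces.Torus.gradient (φ t) x,
        FunctionSpaces.Torus.gradient (θ t) x⟫_ℝ) volume := (hφt.gradient.inner hθt.gradient).integrable
    have hsplit : (fun x => ⟪FunctionSpaces.Torus.gradient (η t) x, FunctionSpaces.Torus.gradient (θ t) x⟫_ℝ) =
        fun x => ⟪FunctionSpaces.Torus.gradient (θ t) x, FunctionSpaces.Torus.gradient (θ t) x⟫_ℝ -
          ⟪FunctionSpaces.Torus.gradient (φ t) x, FunctionSpaces.Torus.gradient (θ t) x⟫_ℝ := by
      funext x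
      rw [hgrad x, inner_sub_left]
    rw [hsplit, integral_sub k1 k2, scalarGradNormSq]
    congr 1
    · refine integral_congr_ae (Eventually.of_forall fun x => ?_)
      exact real_inner_self_eq_norm_sq _
    · refine integral_congr_ae (Eventually.of_forall fun x => ?_)
      exact real_inner_comm _ _
  have g2 : ∫ x, η t x * FunctionSpaces.Torus.laplacian (φ t) x =
      -((∫ x, ⟪FunctionSpaces.Torus.gradient (θ t) x, FunctionSpaces.Torus.gradient (φ t) x⟫_ℝ) -
        scalarGradNormSq (φ t)) := by
    rw [integral_mul_laplacian_eq_neg_integral_inner_gradient hηt hφt]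
    congr 1
    have k1 : Integrable (fun x => ⟪FunctionSpaces.Torus.gradient (θ t) x,
        FunctionSpaces.Torus.gradient (φ t) x⟫_ℝ) volume := (hθt.gradient.inner hφt.gradient).integrable
    have k2 : Integrable (fun x => ⟪FunctionSpaces.Torus.gradient (φ t) x,
        FunctionSpaces.Torus.gradient (φ t) x⟫_ℝ) volume := (hφt.gradient.inner hφt.gradient).integrable
    have hsplit : (fun x => ⟪FunctionSpaces.Torus.gradient (η t) x, FunctionSpaces.Torus.gradient (φ t) x⟫_ℝ) =
        fun x => ⟪FunctionSpaces.Torus.gradient (θ t) x, FunctionSpaces.Torus.gradient (φ t) x⟫_ℝ -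
          ⟪FunctionSpaces.Torus.gradient (φ t) x, FunctionSpaces.Torus.gradient (φ t) x⟫_ℝ := by
      funext x
      rw [hgrad x, inner_sub_left]
    rw [hsplit, integral_sub k1 k2, scalarGradNormSq]
    congr 1
    refine integral_congr_ae (Eventually.of_forall fun x => ?_)
    exact real_inner_self_eq_norm_sq _
  rw [hpt, integral_sub j12 j3, integral_sub j1 j2, integral_const_mul, integral_const_mul,
    integral_const_mul, g1, g2, integral_mul_inner_gradient_self_eq_zero hut (hθ.divFree t ht) hηt]
  ring

/-- **Viscous–inviscid closeness in product form** (Cheskidov's (4.3); Feng–Iyer's Lemma 5.3 before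
the flow-map bound on `‖φ_s‖₁`). For `κ ≥ 0`, a classical solution `θ` of `∂ₜθ + u·∇θ = κΔθ` and a
classical solution `φ` of the transport equation `∂ₜφ + u·∇φ = 0` with the same drift on
`S ⊇ [a, b]` and the same datum `θ(a) = φ(a)`: for `t ∈ [a, b]`,
`‖θ(t) - φ(t)‖²_{L²} ≤ 2κ (∫ₐᵗ‖∇θ‖²_{L²})^{1/2} (∫ₐᵗ‖∇φ‖²_{L²})^{1/2}`
(`d/dt‖θ - φ‖² = -2κ‖∇θ‖² + 2κ∫⟪∇θ, ∇φ⟫ ≤ 2κ‖∇θ‖‖∇φ‖`, integrate, Cauchy–Schwarz in time).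
[cite: Cheskidov2023, §4 (4.3)] [cite: FengIyer2019, §5.1 Lemma 5.3] -/
theorem integral_sub_sq_le_sqrt_mul_sqrt (hθ : IsClassicalScalarTransportOn S κ u θ)
    (hφ : IsClassicalScalarTransportOn S 0 u φ) (hκ : 0 ≤ κ) {a b : ℝ} (hI : Icc a b ⊆ S)
    (h0 : θ a = φ a) {t : ℝ} (ht : t ∈ Icc a b) :
    ∫ x, (θ t x - φ t x) ^ 2 ≤
      2 * κ * (Real.sqrt (∫ s in a..t, scalarGradNormSq (θ s)) *
        Real.sqrt (∫ s in a..t, scalarGradNormSq (φ s))) := by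
  rcases eq_or_lt_of_le ht.1 with hta | hat
  · subst hta
    simp [h0]
  have hab : a < b := hat.trans_le ht.2
  -- restrict to `[a, b]`
  have hθ' := hθ.restrict_Icc hab hI
  have hφ' := hφ.restrict_Icc hab hI
  have hconv : Convex ℝ (Icc a b) := convex_Icc a b
  have hU : UniqueDiffOn ℝ (Icc a b) := uniqueDiffOn_Icc hab
  set Gθ : ℝ → ℝ := fun s => scalarGradNormSq (θ s) with hGθ_def
  set Gφ : ℝ → ℝ := fun s => scalarGradNormSq (φ s) with hGφ_def
  set P : ℝ → ℝ := fun s => ∫ x, ⟪FunctionSpaces.Torus.gradient (θ s) x,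
    FunctionSpaces.Torus.gradient (φ s) x⟫_ℝ with hP_def
  set D : ℝ → ℝ := fun s => -(2 * κ) * Gθ s - 2 * 0 * Gφ s + 2 * (κ + 0) * P s with hD_def
  have hderiv : ∀ s ∈ Icc a b, HasDerivWithinAt (fun σ => ∫ x, (θ σ x - φ σ x) ^ 2) (D s)
      (Icc a b) s := fun s hs =>
    hθ'.hasDerivWithinAt_integral_sub_sq_of_diffusivities hφ' hconv hs
  -- continuity of the ingredients on `[a, b]`
  have hGθc : ContinuousOn Gθ (Icc a b) := hθ'.continuousOn_scalarGradNormSq hconv hU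
  have hGφc : ContinuousOn Gφ (Icc a b) := hφ'.continuousOn_scalarGradNormSq hconv hU
  have hPc : ContinuousOn P (Icc a b) :=
    ((hθ'.smooth_scalar.gradient hU).inner (hφ'.smooth_scalar.gradient hU)).continuousOn_integral hconv
  have hDc : ContinuousOn D (Icc a b) := by
    have c : ContinuousOn (fun s => -(2 * κ) * Gθ s - 2 * 0 * Gφ s + 2 * (κ + 0) * P s) (Icc a b) :=
      ((continuousOn_const.mul hGθc).sub (continuousOn_const.mul hGφc)).add
        (continuousOn_const.mul hPc)
    exact c
  -- the pointwise bound `D ≤ 2κ √Gθ √Gφ`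
  have hDle : ∀ s ∈ Icc a b, D s ≤ 2 * κ * (Real.sqrt (Gθ s) * Real.sqrt (Gφ s)) := by
    intro s hs
    have hθs : FunctionSpaces.Torus.IsSmooth (θ s) := hθ'.smooth_scalar.isSmooth_slice hs
    have hφs : FunctionSpaces.Torus.IsSmooth (φ s) := hφ'.smooth_scalar.isSmooth_slice hs
    have hcs := FunctionSpaces.Torus.integral_mul_le_sqrt_mul_sqrt hθs.gradient.continuous.norm
      hφs.gradient.continuous.norm
    have hPle : P s ≤ ∫ x, ‖FunctionSpaces.Torus.gradient (θ s) x‖ *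
        ‖FunctionSpaces.Torus.gradient (φ s) x‖ :=
      integral_mono (hθs.gradient.inner hφs.gradient).integrable
        ((hθs.gradient.continuous.norm.mul hφs.gradient.continuous.norm).integrable_unitAddTorus)
        fun x => real_inner_le_norm _ _
    have hG0 : 0 ≤ Gθ s := scalarGradNormSq_nonneg _
    have hD : D s = -(2 * κ) * Gθ s - 2 * 0 * Gφ s + 2 * (κ + 0) * P s := rfl
    have hGθ : Gθ s = ∫ x, ‖FunctionSpaces.Torus.gradient (θ s) x‖ ^ 2 := rfl
    have hGφ : Gφ s = ∫ x, ‖FunctionSpaces.Torus.gradient (φ s) x‖ ^ 2 := rfl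
    rw [hD, hGθ, hGφ]
    rw [hGθ] at hG0
    nlinarith [hPle.trans hcs, hκ]
  -- integrate from `a` to `t`
  have hta : Icc a t ⊆ Icc a b := Icc_subset_Icc le_rfl ht.2
  have hDi : IntervalIntegrable D volume a t := (hDc.mono hta).intervalIntegrable_of_Icc ht.1
  have hRc : ContinuousOn (fun s => 2 * κ * (Real.sqrt (Gθ s) * Real.sqrt (Gφ s))) (Icc a t) :=
    continuousOn_const.mul (((hGθc.mono hta).sqrt).mul ((hGφc.mono hta).sqrt))
  have hRi : IntervalIntegrable (fun s => 2 * κ * (Real.sqrt (Gθ s) * Real.sqrt (Gφ s))) volume a t :=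
    hRc.intervalIntegrable_of_Icc ht.1
  have hFTC : ∫ s in a..t, D s = (∫ x, (θ t x - φ t x) ^ 2) - ∫ x, (θ a x - φ a x) ^ 2 :=
    intervalIntegral.integral_eq_sub_of_hasDerivAt_of_le ht.1
      (fun s hs => ((hderiv s (hta hs)).continuousWithinAt).mono hta)
      (fun s hs => (hderiv s (hta (Ioo_subset_Icc_self hs))).hasDerivAt
        (Icc_mem_nhds hs.1 (hs.2.trans_le ht.2)))
      hDi
  have hmono : ∫ s in a..t, D s ≤ ∫ s in a..t, 2 * κ * (Real.sqrt (Gθ s) * Real.sqrt (Gφ s)) :=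
    intervalIntegral.integral_mono_on ht.1 hDi hRi fun s hs => hDle s (hta hs)
  have h0' : ∫ x, (θ a x - φ a x) ^ 2 = 0 := by simp [h0]
  rw [intervalIntegral.integral_const_mul] at hmono
  -- Cauchy–Schwarz in time
  have hcs := integral_sqrt_mul_sqrt_le ht.1 (hGθc.mono hta) (hGφc.mono hta)
    (fun s _ => scalarGradNormSq_nonneg _) (fun s _ => scalarGradNormSq_nonneg _)
  have h2κ : 0 ≤ 2 * κ := by positivity
  calc ∫ x, (θ t x - φ t x) ^ 2 = ∫ s in a..t, D s := by rw [hFTC, h0', sub_zero]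
    _ ≤ 2 * κ * ∫ s in a..t, Real.sqrt (Gθ s) * Real.sqrt (Gφ s) := hmono
    _ ≤ 2 * κ * (Real.sqrt (∫ s in a..t, Gθ s) * Real.sqrt (∫ s in a..t, Gφ s)) :=
        mul_le_mul_of_nonneg_left hcs h2κ

end Diffusivities

end IsClassicalScalarTransportOn

end Torus

end Literature.Analysis.FluidPDE

end
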